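import Summits.ResolutionOfSingularities.ResolutionOfSingularities.Theorems.FrobeniusLadderFInjectiveMacaulayficationLocalFullificationDimFour
import HarnessLib

/-!
# (L4♭) `LocalFullificationDimFourFibre` — the FIBRE-SUPPORTED weakening of the candidate d = 4 residue (L4) of the crux
# (crux `FInjectiveMacaulayfication` stmt-ResolutionOfSingularities-15315, chain w45a; res-L1-w45a-plan-1 RULING R17.1 §4 «REFINEMENT OF RECORD»;
# seat res-L1-w45a-stub-2 g6)

[OURS · L1 W4.5a] STATEMENT file (`--supports stmt-ResolutionOfSingularities-15315 --as helper`); ONE `Prop`-valued CANDIDATE statement of OURS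
(`@[conjecture] def`, consumed only as a hypothesis; no instance, no notation, no named fact) and its comparison with (L4); replaces the role of NO
printed item; NOT a statement of the manuscript; AI-written (AI review is weaker than expert review).

WHAT. (L4♭) is res-L1-w45a-lead-1's (L4) `LocalFullificationDimFour.LocalFullificationDimFour` (p583849) VERBATIM except for ONE conjunct of the
conclusion: the support condition on the local centre `𝓚`
* (L4):  `(𝓚.support : Set S') ⊆ (Scheme.regularLocus S')ᶜ`            — the centre lies in the SINGULAR locus of `S'`;
* (L4♭): `∀ s ∈ (𝓚.support : Set S'), g.base s = closedPoint 𝒪_{X,x}`   — the centre lies in the CLOSED FIBRE of `g : S' → Spec 𝒪_{X,x}`.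
Since `S'` is regular off the closed fibre (the hypothesis `hreg` of both statements), `Sing S' ⊆ g⁻¹(x)`, so **(L4) ⇒ (L4♭)**
(`localFullificationDimFourFibre_of_localFullificationDimFour` below): (L4♭) is the WEAKER registered residue — centres through REGULAR points of the
closed fibre are admitted (as Cossart–Piltant-(ii)-shaped towers on intermediate models produce them), only fibre support is asked.

WHY IT SUFFICES (plan-1 R17.1 §4; checked on the tree text by this seat). res-L1-w45a-stub-3's F-Temkin induction
`FTemkinClosedPoints.full_model_of_regularOffFinite_of_L4` (p584097) consumes the support conjunct of (L4) at exactly ONE place: to derive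
`h𝓚b : ∀ s ∈ supp 𝓚, f (pr₁ s) = b` («the local centre lies over the closed point `b`»), from which the extension of `𝓚` to `X'` (Temkin
Lemma 2.1.1) is supported in `f⁻¹(b)` — hence in `f⁻¹(Sing X)` — and the steps at distinct closed points do not interact. Under (L4♭) `h𝓚b` is
IMMEDIATE (`f ∘ pr₁ = fromSpecStalk b ∘ g` and `fromSpecStalk b (closedPoint) = b`), so the whole dim-4 slice — F-Temkin, the integral form
`FInjectiveMacaulayficationDimFourOfL4.fiModel_integral_dimLe4_of_L4` (p584558) and the crux's own ∀-text on `dim X ≤ 4`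
`DimLe4Reduced.fInjectiveMacaulayfication_dimLe4_of_L4` (p585410) — goes through with (L4♭) in place of (L4) (this seat's companion files
`…FTemkinClosedPointsFibre`, `…DimLe4OfL4Fibre`). A later door may therefore register `stub_localFullificationDimFourFibre` instead of
`stub_localFullificationDimFour`.

JUNK CHECKS (as for (L4)): `I ≠ ⊥` excludes `S' = ∅`; `S'` regular ⇒ `𝓚 := ⊤` works (`supp ⊤ = ∅`, the fibre clause is vacuous, every blowing up
along `⊤` is an isomorphism onto the regular — hence FULL — `S'`); a NON-closed `x` of local dimension 4 (ambient dimension ≥ 5) is covered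
verbatim and harmless. SPLIT for the instance programme unchanged: CM-half known (Kawasaki 2000 / Česnavičius 2021, context only), F-half open.
[candidate statement, OURS; cite: Temkin2008, Prop. 2.3.4 and Lemma 2.1.1 (shape)]
-/

-- single-problem summit: the doubled namespace component is forced
set_option linter.dupNamespace false

noncomputable section

open AlgebraicGeometry CategoryTheory Literature.AlgebraicGeometry.Resolution TopologicalSpace IsLocalRing

namespace Summit.ResolutionOfSingularities.ResolutionOfSingularities.Theorems.FInjectiveMacaulayfication.LocalFullificationDimFourFibre

open Summit.ResolutionOfSingularities.ResolutionOfSingularities.Theorems.FInjectiveMacaulayfication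

/-- [OURS · CANDIDATE statement, not a fact] **(L4♭) LOCAL FULL-IFICATION IN DIMENSION FOUR, FIBRE-SUPPORTED CENTRE.** For a prime `p`, a field
`k` of characteristic `p`, an integral separated `k`-scheme `X` of finite type, a point `x ∈ X` with `dim 𝒪_{X,x} = 4`, and a blowing up
`g : S′ → Spec 𝒪_{X,x}` along an ideal sheaf `I ≠ ⊥` such that `S′` is REGULAR at every point off the closed fibre `g⁻¹(x)`: there is an ideal
sheaf `𝓚 ≠ ⊥` on `S′`, SUPPORTED IN THE CLOSED FIBRE (`g s = x` for every `s ∈ supp 𝓚`; `𝓚 = ⊤` allowed), such that EVERY blowing up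
`S″ → S′` along `𝓚` is FULL at EVERY point (`SliceableCentre.FullCl`: domain ∧ systems of parameters weakly regular ∧ parameter ideals Frobenius
closed — the crux's stalk clause). Weaker than (L4) `LocalFullificationDimFour` (centre in `Sing S′ ⊆ g⁻¹(x)`), and sufficient for the dim-4
slice of the crux (plan-1 R17.1 §4). CM-half known (Kawasaki/Česnavičius), F-half open. [candidate statement, OURS; open] -/
@[conjecture] def LocalFullificationDimFourFibre : Prop :=
  ∀ (p : ℕ), p.Prime → ∀ (k : Type) [Field k] [CharP k p]
    (X : Scheme.{0}) (f : X ⟶ Spec (.of k)),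
      IsSeparated f → LocallyOfFiniteType f → QuasiCompact f → IsIntegral X →
      ∀ x : X, ringKrullDim (X.presheaf.stalk x) = 4 →
      ∀ (S' : Scheme.{0}) (g : S' ⟶ Spec (X.presheaf.stalk x)) (I : (Spec (X.presheaf.stalk x)).IdealSheafData),
        I ≠ ⊥ → IsBlowup g I →
        (∀ s : S', g.base s ≠ closedPoint (X.presheaf.stalk x) → s ∈ Scheme.regularLocus S') →
        ∃ 𝓚 : S'.IdealSheafData, 𝓚 ≠ ⊥ ∧ (∀ s ∈ (𝓚.support : Set S'), g.base s = closedPoint (X.presheaf.stalk x)) ∧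
          ∀ (S'' : Scheme.{0}) (π : S'' ⟶ S'), IsBlowup π 𝓚 →
            ∀ s : S'', SliceableCentre.FullCl p (S''.presheaf.stalk s)

/-- **(L4) ⇒ (L4♭)**: a centre supported in the singular locus of a scheme that is regular off its closed fibre is supported in the closed fibre.
So (L4♭) is the weaker (or equal) candidate residue. [folklore] -/
theorem localFullificationDimFourFibre_of_localFullificationDimFour
    (hL4 : LocalFullificationDimFour.LocalFullificationDimFour) : LocalFullificationDimFourFibre := by
  intro p hp k _ _ X f hsep hft hqc hint x hx S' g I hI hg hreg
  obtain ⟨𝓚, h𝓚ne, h𝓚supp, h𝓚full⟩ := hL4 p hp k X f hsep hft hqc hint x hx S' g I hI hg hreg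
  refine ⟨𝓚, h𝓚ne, fun s hs => ?_, h𝓚full⟩
  by_contra hne
  exact h𝓚supp hs (hreg s hne)

end Summit.ResolutionOfSingularities.ResolutionOfSingularities.Theorems.FInjectiveMacaulayfication.LocalFullificationDimFourFibre

end
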